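import Literature.MathematicalPhysics.QuantumFieldTheory.Balaban1983to89.B9SupplySockB9P3ZdAtHermInAk

/-!
# `Balaban1983to89.B9SupplySockB9P3ZdDatum` — [Balaban1985RegularSpaces] (1.58)–(1.59) p. 86 ∕ [Balaban1985BackgroundPropagators] (3.27), (3.47), (3.69),
# (3.16), (3.20): EDITION U — THE β COLLAR-SOCKET MEMBER SUPPLIER WITH EVERY BINDER IN THE DATUM'S CURRENCY AND NO FRAME AT ALL.  The five letters of
# `G(U₀)`, `Δ′(U₀)`, `D R(U₀) 𝟙 D*`, `Q*aQ(U₀)` and the three global (3.47) entries at `γ = −3` are hypotheses on ONE operator record `ops` at ONE member,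
# each quantified over the socket's OWN data `U₀ ∈ 𝔄_m({Ω_j}, α₀)` (`B8Ineq132.InAk`) or over all unitary `U₀`: `InvAtHI` (g20), `CurvAtInAk` (g16),
# `LandauAtU` (here), `AvgAtγ` (g16), `GlobAtI` (here).  No `B9.Geometry ∕ Backgrounds ∕ KernelFamily`, no dictionary, no Prop. 6, no `Reg335`

statement-level skeleton of published theorems with citation tags; proofs where landed; nothing here is a claim about the
Yang–Mills mass gap

`[Balaban1985RegularSpaces]` ("B8", CMP **99** (1985) 75–102): (1.58)–(1.59) p. 86 («Theorem 3.3 of [4] implies the bounds (1.59)»), Prop. 3 p. 87, (1.7)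
p. 77, (1.33) p. 82, (1.31) p. 82.  `[Balaban1985BackgroundPropagators]` ("B9", CMP **99** (1985) 389–434; journal page = PDF page + 388): (3.27) p. 395,
(3.47) p. 398 (the global norms `|Gλ|_{(2+γ)}, |∇_UGλ|_{(1+γ)}, |Δ_UGλ|_{(γ)}`), Thm 3.3 p. 399, (3.69) p. 404, (3.16) p. 393, (3.20)–(3.26) pp. 394–395.
`[Balaban1984PropagatorsII]` (2.3) p. 224.

CITATION HEADER ∕ WHY THIS FILE (cell `pub-ymgap`, HUMAN RULING D-0062; seat `pub-ymgap-dag-n06-b` (g20), binder∕letter owner of the junction J-N06→N05).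
LOCATED-SELF-6∕7 (this seat, g20): at a `cubeFam false` member the frame's class (3.35) (`bgZd.Reg335` on cubes inside `□₀`) cannot see the collar
plaquettes the genuine `Δ_a(U₀)↾E(□₀)` reads; the class contains backgrounds flat inside `□₀` with a plaquette variable `−1` on a plaquette through a crossing
bond, where the form `⟨A, Δ_a(U₀)A⟩_τ` of the genuine record is NEGATIVE in the direction of that bond (each of the `2(d−1)` plaquettes through it sits
at the maximum of `‖U(∂p) − 1‖²`, the Landau term adds at most one `|h|²η⁻²`, `Q*aQ` is switched off by its (1.7) guard) — so every binder that asserts a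
UNIFORM statement about the genuine `G_𝔤(U₀)` over that class (`InvAtH`, `PosDefInClassAtH`, and Theorem 3.3's block `h33U` for `GAZdFam … (withGopZdH
(opsAllZd …))`) is uninhabitable there, while the same statements keyed by the DATUM's class `𝔄_m({□_j}, α₀)` are theorems per member
(`B9Thm311PerMemberCubeZdTouching`, `B9Thm311InvAtHIWitnessCubeZd`, and the companion `B9Thm33GlobalBlockWitnessCubeZd`).  THIS FILE therefore states the
member supplier with NO frame: the (3.47) input is the binder `GlobAtI` — exactly the three global entries at `γ = −3` that [B8] p. 86 reads for (1.59)
lines 1, 2, 4 (this lineage's g4 census: «entry 2 `G∇*` unused; the local (3.42)–(3.46) entries are not read by the junction») — and the Landau input is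
the frame-free `LandauAtU` (the genuine `D R(U₀) 𝟙 D*` kills Landau fields at EVERY unitary `U₀`, `B9Eq321LandauProjectionZd.projR_covDivB_eq_zero_of_
isLandau138`).  Proof = `B9SupplySockB9P3ZdAtHermInAk.sockB9P3D4γIHI_at` VERBATIM with the dictionary∕Prop-6∕frame lines deleted and the three (1.59)
source lines read off `GlobAtI`; threshold `cP = min{1∕16, aI, 1∕(2B₀c₆₉M+1)}` (the frame-keyed entries `c₆∕M`, `a₀∕(K₆M)`, `a₃∕(K₆M)` are gone).

WHAT IS DEFINED ∕ PROVED (2 def + 3 thm; no `sorry`, no `instance`, no `notation`).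
* §1 ★ `LandauAtU L ops M i m` (∀ unitary `U₀`, ∀ `A ∈ E(Ω₀)` Landau (1.38): `(D R(U₀) 𝟙 D* A) = 0`), `landauAtU_iff_forall` (unfolding);
  ★ `GlobAtI L ops aT B₀ M i m` (∀ `α₀ ≤ aT`, ∀ unitary `U₀ ∈ 𝔄_m({Ω_j}, α₀)`, ∀ `J`: the (3.47) entries n = 0, 1, 3 at `γ = −3` of `G(U₀)J` are
  `≤ B₀·|J|₍₋₃₎`), `globAtI_anti` (antitone in `aT`, monotone in `B₀`).
* §2 ★★★ `sockB9P3D4βU_at` — THE FRAME-FREE MEMBER SUPPLIER: `2 ≤ d`, `1 ≤ L`, `1 ≤ M`, `Margin2 i.Ω`, `InvAtHI L ops aI M i m`, `CurvAtInAk L ops c69 M i m`,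
  `LandauAtU L ops M i m`, `AvgAtγ L ops q ΛbP M i m` + `SeesDom L m (i.Ω 0) ΛbP`, `GlobAtI L ops aI B₀ M i m`, `0 ≤ c69`, `0 ≤ q`, `0 < B₀` ⟹
  `SockB9P3D4β L B₀′ ((20d+2)B₀′) cP i.η m i.Ω i.Λs ΛbP`, `B₀′ = max{1, 2B₀max{1,q}}`, `cP = min{1∕16, aI, 1∕(2B₀c₆₉M+1)}`.

HONEST SCOPE.  A re-keying + verbatim re-proof; no new estimate; the binders are HYPOTHESES (their inhabitation by the genuine record at cube members is
the companions' business: four are landed theorems, `GlobAtI` is `B9Thm33GlobalBlockWitnessCubeZd`'s); count-neutral helper of K1⁸ (`--supports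
stmt-QuantumFields-26907`); N05∕N06 NOT discharged; one finite `𝕋⁴` programme at fixed `ε`, Bałaban as printed; R4 closes only the conditional finite-`𝕋⁴`
rung `BalabanLadder.UV` — nothing continuum ∕ `ℝ⁴` ∕ OS ∕ mass gap ∕ Clay.  Unit `pub-ymgap-dag-n06-b` (g20), 2026-08-28.
-/

noncomputable section

open NormedSpace

namespace Literature.MathematicalPhysics.QuantumFieldTheory.Balaban1983to89.B9SupplySockB9P3ZdDatum
open Complex (I)
open MatrixLog B7Prop1Explicit B7Prop2Explicit B7Prop1Local B7Eq92Concrete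
open B7Prop4GeneralLevels (linCovIter)
open B7Eq78Linearization (conjR)
open B8Ineq132 (covDerivFwd covDeriv InAk BondTouches)
open B8Eq119TwistedAxial (Restr129 InAx)
open B8Eq184Proof (cfgExp)
open B8Lemma1NonAbelian (mulCfg)
open B8Eq140Level (SideTouches)
open B8Eq146AExpansion (iEta plaqCovDeriv)
open B8Eq143PlaqExpansion (pdiv)
open B8Eq155JBound (Jcur wsup)
open B8ScaledSupNorm (bondNorm msup weight Bdd)
open B8Eq138LandauZd (IsLandau138 IsLandau138W IsLandau146 IsLandau146W InR138 QT covDivB logCfg covLap)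
open B8LanF146 (LanF146)
open B8LeafModelZd (ZdIdx)
open B8LeafModelZd3 (SockB9P3)
open B9Eq340HolderZd (hquot AdmPair trans)
open B9SupplySockB9P3ZdLetters (OpsZd deltaAOf DictGlob Prop6Feed HolderGlob)
open B9SupplySockB9P3ZdLettersOmega (OnDom restrictDom outerPart Margin2 InvOnDom CurvSmallDom LandauKillsDom AvgBoundDom SockB9P3D4)
open B9SupplySockB9P3ZdOmega (collar_arith)
open B9SupplySockB9P3ZdSrc (GopAdd SourceTermDom SourceHolderDom msup_eq_zero_of_not_bdd msup_le_add_of_norm_le hquot_add_le hquot_sub_le trans_add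
  apriori_arith_src)
open B9SupplySockB9P3ZdAt (DictAt Prop6At InvAt CurvAt LandauAt AvgAt HolderAt GopAddAt SrcAt SrcHolderAt)
open B9SupplySockB9P3ZdAtLin (LinBddAt)
open B9SupplySockB9P3ZdUnivWitness (BddF)
open B9SupplySockB9P3ZdGammaUniv (AvgAtP)
open B9SupplySockB9P3ZdGammaInAk (CurvAtInAk)
open B8Prop3GaugeFixedKLevel (mem_unitaryUnits_of_mgauge_eq mulCfg_eq_gaugeAct_of_mgauge_eq)
open B9SupplySockB9P3ZdGammaUnivDelta (HolderAtδ)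
open B9SupplySockB9P3ZdGammaUnivDelta2 (HolderAtδ2 SockB9P3H2)

-- `Site` alone could resolve to the torus sites of `Setup.lean`; re-export the `ℤ^d` sites of `B7Prop1Explicit`.
export B7Prop1Explicit (Site)
open B7Prop1Explicit (e U1)
open B7Prop1Local (InBox loK bondHiK)
open B7Prop2Explicit (unitaryUnits unitaryUnits_le_U1)
open B8Eq138LandauZd (IsLandau138 IsLandau138W QT covDivB logCfg covLap)
open B9SupplySockB9P3ZdLetters (OpsZd deltaAOf)
open B9SupplySockB9P3ZdLettersOmega (OnDom restrictDom outerPart Margin2 restrictDom_of)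
open B9SupplySockB9P3ZdAt (DictAt Prop6At InvAt CurvAt LandauAt)
open B9SupplySockB9P3ZdBeta (CrossB SockB9P3D4β AvgAtβ)
open B8Eq131CubesAdmissible (cubeFam cubeFam_false_zero)
open B8Eq131Cubes (cube sqLo sqHi cube_anti)
open B8CubeMemberZd (cubeLamB)
open B8Ineq159FlatCubeMemberPrinted (cubeLamBP cubeLamBP_box_subset_pred cubeLamBP_zero_bondTouches)
open B9SupplySockB9P3ZdGamma (SeesDom AvgAtγ wsupB1γ_restrictDom seesDom_zero_of_touch seesDom_cubeLamBP cubeLamBP' seesDom_cubeLamBP'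
  mem_cubeLamBP_zero_of_bondTouches mem_cubeLamBP'_zero_of_inner cubeLamBP'_zero_bondTouches)

open B9SupplySockB9P3ZdAtHerm (isSelfAdjoint_restrictDom)
open B9SupplySockB9P3ZdAtHermInAk (InvAtHI)

variable {d : ℕ} {𝔸 : Type*} [CStarAlgebra 𝔸]

/-! ## §1 The two frame-free binders: `LandauAtU` and `GlobAtI` -/

section Binders

variable (L : ℕ)

/-- ★ **THE LANDAU LETTER KILLS LANDAU FIELDS AT EVERY UNITARY BACKGROUND** — `B9SupplySockB9P3ZdAt.LandauAt` with the frame line dropped: for every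
unitary `U₀` and every `A ∈ E(Ω₀)` satisfying the Landau condition (1.38) of the member, `(D R(U₀) 𝟙 D* A)(b) = 0` at every bond (print: `R(U₀)` projects
onto the orthogonal complement of the Landau fields' divergences, (3.20)–(3.21); the genuine letter does this at EVERY unitary `U₀`).
[cite: Balaban1985BackgroundPropagators, (3.20)–(3.21) p.394, (3.26) p.395; Balaban1985RegularSpaces, (1.38) p.82] -/
def LandauAtU (ops : ℝ → ZdIdx d L → ℕ → OpsZd d 𝔸) (M : ℝ) (i : ZdIdx d L) (m : ℕ) : Prop :=
  ∀ (U₀ : Site d → Fin d → 𝔸ˣ), (∀ x κ, U₀ x κ ∈ unitaryUnits 𝔸) →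
    ∀ A : Site d → Fin d → 𝔸, OnDom L m i.η i.Ω A → IsLandau138 L m i.η (i.Ω 0) (i.Λs m) U₀ A →
      ∀ (x : Site d) (μ : Fin d), (ops M i m).DRDs U₀ A x μ = 0

/-- `LandauAtU` implies the frame-keyed `LandauAt` (any frame, any guards). [cite: Balaban1985BackgroundPropagators, (3.20)–(3.21) p.394 (bookkeeping)] -/
theorem landauAt_of_landauAtU {I : Type} (bg : I → B9.Backgrounds) (mem : ℝ → ZdIdx d L → ℕ → I)
    (ιCfg : ∀ (M : ℝ) (i : ZdIdx d L) (m : ℕ) (U₀ : Site d → Fin d → 𝔸ˣ), (∀ x κ, U₀ x κ ∈ unitaryUnits 𝔸) → (bg (mem M i m)).Cfg)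
    {ops : ℝ → ZdIdx d L → ℕ → OpsZd d 𝔸} {M : ℝ} {i : ZdIdx d L} {m : ℕ} (h : LandauAtU L ops M i m) (c35 a₃ : ℝ) :
    LandauAt bg L mem ιCfg ops c35 a₃ M i m :=
  fun _ U₀ hU₀ _ _ _ A hA hL x μ => h U₀ hU₀ A hA hL x μ

/-- ★ **THE THREE GLOBAL (3.47) ENTRIES OF `G(U₀)` AT `γ = −3`, ON THE DATA OF THE JUNCTION** — exactly what [B8] p. 86 reads off [B9] Theorem 3.3 for (1.59)
lines 1, 2, 4 (`|G(U₀)J|₍₋₁₎`, `|∇_{U₀}G(U₀)J|₍₋₂₎`, `|Δ_{U₀}G(U₀)J|₍₋₃₎ ≤ B₀·|J|₍₋₃₎`), for every `α₀ ≤ aT`, every unitary `U₀ ∈ 𝔄_m({Ω_j}, α₀)` and every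
bond field `J`.  A `Prop` on the operator record (frame-free twin of the `glob` block of `B9.Ineq342_346_347` read through `DictAt`).
[cite: Balaban1985BackgroundPropagators, (3.47) p.398, Thm 3.3 p.399; Balaban1985RegularSpaces, (1.59) p.86, (1.7) p.77, (1.33) p.82] -/
def GlobAtI (ops : ℝ → ZdIdx d L → ℕ → OpsZd d 𝔸) (aT B₀ : ℝ) (M : ℝ) (i : ZdIdx d L) (m : ℕ) : Prop :=
  ∀ (α₀ : ℝ) (U₀ : Site d → Fin d → 𝔸ˣ), (∀ x κ, U₀ x κ ∈ unitaryUnits 𝔸) → 0 < α₀ → α₀ ≤ aT → InAk L m i.η α₀ i.Ω U₀ →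
    ∀ J : Site d → Fin d → 𝔸,
      msup L m i.η (-(1 : ℝ)) (fun j (b : Site d × Fin d) => SideTouches (i.Ω j) b.1 b.2) (fun b => (ops M i m).Gop U₀ J b.1 b.2) ≤
          B₀ * bondNorm L m i.η (-(3 : ℝ)) i.Ω J ∧
        msup L m i.η (-(2 : ℝ)) (fun j (t : Fin d × Fin d × Site d) => SideTouches (i.Ω j) t.2.2 t.2.1)
            (fun t => covDerivFwd i.η U₀ t.1 (fun z => (ops M i m).Gop U₀ J z t.2.1) t.2.2) ≤ B₀ * bondNorm L m i.η (-(3 : ℝ)) i.Ω J ∧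
        bondNorm L m i.η (-(3 : ℝ)) i.Ω (fun x μ => covLap i.η U₀ (fun z => (ops M i m).Gop U₀ J z μ) x) ≤ B₀ * bondNorm L m i.η (-(3 : ℝ)) i.Ω J

/-- `GlobAtI` is antitone in the threshold `aT` and monotone in the constant `B₀`. [cite: Balaban1985BackgroundPropagators, (3.47) p.398 (bookkeeping)] -/
theorem globAtI_anti {ops : ℝ → ZdIdx d L → ℕ → OpsZd d 𝔸} {aT aT' B₀ B₀' : ℝ} (ha : aT' ≤ aT) (hB : B₀ ≤ B₀') {M : ℝ} {i : ZdIdx d L} {m : ℕ}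
    (h : GlobAtI L ops aT B₀ M i m) : GlobAtI L ops aT' B₀' M i m := by
  intro α₀ U₀ hU₀ hα hαT hIn J
  obtain ⟨h0, h1, h3⟩ := h α₀ U₀ hU₀ hα (hαT.trans ha) hIn J
  have hn : 0 ≤ bondNorm L m i.η (-(3 : ℝ)) i.Ω J := B8ScaledSupNorm.msup_nonneg L m i.hη.le _ _ _
  have hm : B₀ * bondNorm L m i.η (-(3 : ℝ)) i.Ω J ≤ B₀' * bondNorm L m i.η (-(3 : ℝ)) i.Ω J := mul_le_mul_of_nonneg_right hB hn
  exact ⟨h0.trans hm, h1.trans hm, h3.trans hm⟩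

end Binders

/-! ## §2 The frame-free member supplier `sockB9P3D4βU_at` -/

section Supply

variable [Nontrivial 𝔸] (L : ℕ) (ops : ℝ → ZdIdx d L → ℕ → OpsZd d 𝔸)

/-- ★★★ **EDITION U — THE β COLLAR-SOCKET MEMBER SUPPLIER WITH NO FRAME.**  At one member `(M, i, m)` with `Margin2 i.Ω`, `2 ≤ d`, `1 ≤ L`, `1 ≤ M`, for a
letter record `ops` and a datum class `ΛbP` read inside `Ω₀` (`SeesDom`): the five binders `InvAtHI L ops aI M i m` ((3.27) on the data, g20),
`CurvAtInAk L ops c69 M i m` ((3.69) on the data, g16), `LandauAtU L ops M i m` ((3.20)–(3.21), all unitary `U₀`), `AvgAtγ L ops q ΛbP M i m` ((3.16),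
g16), `GlobAtI L ops aI B₀ M i m` ((3.47) entries 0, 1, 3 at `γ = −3` on the data) ⟹ the four-line collar socket `SockB9P3D4β L B₀′ ((20d+2)B₀′) cP i.η m
i.Ω i.Λs ΛbP` of [Balaban1985RegularSpaces] (1.59) with `B₀′ = max{1, 2B₀max{1,q}}` and `cP = min{1∕16, aI, 1∕(2B₀c₆₉M+1)}` — B8 p. 86's chain «Theorem
3.3 of [4] implies the bounds (1.59)» in kernel, the (3.47) input taken AS A BOUND ON THE DATA instead of through a frame: `A′ = G(U₀)J̃` on `E(Ω₀)`
((1.58)), `J̃ = J + Δ′A′ + 0 + Q*aQA′`, `|J̃|₍₋₃₎ ≤ |J|₍₋₃₎ + c₆₉Mα₀|A′|₍₋₁₎ + q|B₁|`, the a-priori step with `θ ≤ ½`, the collar bookkeeping.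
Proof = `B9SupplySockB9P3ZdAtHermInAk.sockB9P3D4γIHI_at` verbatim minus the frame lines.
[cite: Balaban1985RegularSpaces, (1.58)–(1.59) p.86, (1.31) p.82, Prop. 3 p.87, p.77; Balaban1985BackgroundPropagators, Thm 3.3 p.399, (3.26)–(3.27) p.395, (3.47) p.398, (3.69) p.404, (3.16) p.393; Balaban1984PropagatorsII, (2.3) p.224] -/
theorem sockB9P3D4βU_at (hd2 : 2 ≤ d) (hL : 1 ≤ L) {c69 q aI B₀ : ℝ}
    {M : ℝ} (hM1 : 1 ≤ M) (i : ZdIdx d L) (hMi : Margin2 i.Ω) {m : ℕ}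
    (hinv : InvAtHI L ops aI M i m) (hcurv : CurvAtInAk L ops c69 M i m) (hlan : LandauAtU L ops M i m)
    (ΛbP : ℕ → ℕ → Set (Site d × Fin d)) (havg : AvgAtγ L ops q ΛbP M i m) (hsee : SeesDom L m (i.Ω 0) ΛbP)
    (hglob : GlobAtI L ops aI B₀ M i m) (hc69 : 0 ≤ c69) (hq : 0 ≤ q) (hB₀ : 0 < B₀) :
    SockB9P3D4β (𝔸 := 𝔸) L (max 1 (2 * B₀ * max 1 q)) ((20 * d + 2) * max 1 (2 * B₀ * max 1 q))
      (min (1 / 16) (min aI (1 / (2 * B₀ * c69 * M + 1))))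
      i.η m i.Ω i.Λs ΛbP := by
  intro α₀ α₂ hα₀ hα₀c hα₂ hα₂c U₀ W hU₀ hWu hInA _ hLanW A' hsa h41 hA0
  -- the thresholds
  have hη : 0 < i.η := i.hη
  have hLr : (1 : ℝ) ≤ L := by exact_mod_cast hL
  have hd1 : (1 : ℝ) ≤ d := by exact_mod_cast (le_trans (by norm_num) hd2 : 1 ≤ d)
  have hM0 : 0 < M := lt_of_lt_of_le one_pos hM1
  simp only [le_min_iff] at hα₀c hα₂c
  obtain ⟨-, hα₀I, hα₀θ⟩ := hα₀c
  obtain ⟨hα₂16, -, -⟩ := hα₂c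
  have hκ' : 0 ≤ c69 * M * α₀ := by positivity
  have hθ : B₀ * (c69 * M * α₀) ≤ 1 / 2 := by
    have hpos : 0 < 2 * B₀ * c69 * M + 1 := by positivity
    have h1 : α₀ * (2 * B₀ * c69 * M + 1) ≤ 1 := (le_div_iff₀ hpos).1 hα₀θ
    linarith [hα₀.le]
  have hU₀1 : ∀ x κ, U₀ x κ ∈ U1 𝔸 := fun x κ => unitaryUnits_le_U1 (hU₀ x κ)
  -- the datum and its restriction to the Ω₀-bonds
  have hAglob : ∀ (y : Site d) (τ : Fin d), ‖A' y τ‖ ≤ α₂ * i.η⁻¹ := by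
    intro y τ
    by_cases hmem : ∃ j, j ≤ m ∧ SideTouches (i.Ω j) y τ
    · obtain ⟨j, hj, hs⟩ := hmem
      have hLj : (1 : ℝ) ≤ (L : ℝ) ^ j := one_le_pow₀ hLr
      calc ‖A' y τ‖ ≤ α₂ * ((L : ℝ) ^ j * i.η)⁻¹ := (h41 j hj y τ hs).2
        _ = α₂ * i.η⁻¹ * ((L : ℝ) ^ j)⁻¹ := by rw [mul_inv]; ring
        _ ≤ α₂ * i.η⁻¹ * 1 := by
            apply mul_le_mul_of_nonneg_left (inv_le_one_of_one_le₀ hLj) (by positivity)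
        _ = α₂ * i.η⁻¹ := mul_one _
    · rw [hA0 y τ fun j hj hs => hmem ⟨j, hj, hs⟩, norm_zero]
      positivity
  have hAbd : Bdd L m i.η (-(1 : ℝ)) (fun j (b : Site d × Fin d) => SideTouches (i.Ω j) b.1 b.2) (fun b => A' b.1 b.2) := by
    have e1 : (-(1 : ℝ)) = -((1 : ℕ) : ℝ) := by norm_num
    rw [e1]
    refine B8ScaledSupNorm.bdd_of_forall (c := α₂) fun j hj b hb => ?_
    rw [B8ScaledSupNorm.weight_neg_natCast, pow_one]
    have h := (h41 j hj b.1 b.2 hb).2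
    have hs : 0 < (L : ℝ) ^ j * i.η := B8ScaledSupNorm.scale_pos hL hη j
    calc (L : ℝ) ^ j * i.η * ‖A' b.1 b.2‖ ≤ (L : ℝ) ^ j * i.η * (α₂ * ((L : ℝ) ^ j * i.η)⁻¹) :=
          mul_le_mul_of_nonneg_left h hs.le
      _ = α₂ := by rw [mul_comm α₂, ← mul_assoc, mul_inv_cancel₀ hs.ne', one_mul]
  obtain ⟨Ain, hAin_def⟩ : ∃ Ain : Site d → Fin d → 𝔸, Ain = restrictDom (i.Ω 0) A' := ⟨_, rfl⟩
  have h41b : ∀ j, j ≤ m → ∀ (y : Site d) (τ : Fin d), SideTouches (i.Ω j) y τ → ‖A' y τ‖ ≤ α₂ * ((L : ℝ) ^ j * i.η)⁻¹ :=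
    fun j hj y τ hs => (h41 j hj y τ hs).2
  have hOn : OnDom L m i.η i.Ω Ain := by
    rw [hAin_def]; exact B9SupplySockB9P3ZdLettersOmega.onDom_restrictDom hL hη h41b
  have hAin_glob : ∀ (y : Site d) (τ : Fin d), ‖Ain y τ‖ ≤ α₂ * i.η⁻¹ := fun y τ => by
    rw [hAin_def]; exact (B9SupplySockB9P3ZdLettersOmega.norm_restrictDom_le _ A' y τ).trans (hAglob y τ)
  obtain ⟨a, ha_def⟩ : ∃ a : ℝ,
      a = msup L m i.η (-(1 : ℝ)) (fun j (b : Site d × Fin d) => SideTouches (i.Ω j) b.1 b.2) (fun b => Ain b.1 b.2) := ⟨_, rfl⟩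
  have ha0 : 0 ≤ a := by rw [ha_def]; exact B8ScaledSupNorm.msup_nonneg L m hη.le _ _ _
  -- the collar functional Φ₀ and the pointwise control of the outer part
  obtain ⟨Φ, hΦ_def⟩ : ∃ Φ : ℝ, Φ = msup L m i.η (-(1 : ℝ))
      (fun j (b : Site d × Fin d) => j = 0 ∧ SideTouches (i.Ω 0) b.1 b.2 ∧ ¬ BondTouches (i.Ω 0) b.1 b.2) (fun b => A' b.1 b.2) := ⟨_, rfl⟩
  have hΦ0 : 0 ≤ Φ := by rw [hΦ_def]; exact B8ScaledSupNorm.msup_nonneg L m hη.le _ _ _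
  have hbdΦ : Bdd L m i.η (-(1 : ℝ))
      (fun j (b : Site d × Fin d) => j = 0 ∧ SideTouches (i.Ω 0) b.1 b.2 ∧ ¬ BondTouches (i.Ω 0) b.1 b.2) (fun b => A' b.1 b.2) := by
    have e1 : (-(1 : ℝ)) = -((1 : ℕ) : ℝ) := by norm_num
    rw [e1]
    exact B9SupplySockB9P3ZdLettersOmega.bdd_neg_of_pointwise hL hη 1 fun b => hAglob b.1 b.2
  have hout : ∀ (y : Site d) (τ : Fin d), ‖outerPart (i.Ω 0) A' y τ‖ ≤ i.η⁻¹ * Φ := by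
    intro y τ; rw [hΦ_def]
    exact B9SupplySockB9P3ZdLettersOmega.norm_outerPart_le_phi hη hMi hA0 hbdΦ y τ
  -- the Landau condition for A′, hence for 𝟙_{Ω₀}A′; the source J̃ = Δ_a(U₀)𝟙_{Ω₀}A′ and 𝟙_{Ω₀}A′ = G(U₀)J̃ ((1.58))
  have hLanA : IsLandau138 L m i.η (i.Ω 0) (i.Λs m) U₀ A' :=
    B9SupplySockB9P3Zd.landau_of_landauW hd2 hη U₀ hWu hα₂16 h41 hLanW
  have hLanAin : IsLandau138 L m i.η (i.Ω 0) (i.Λs m) U₀ Ain := by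
    rw [hAin_def]; exact (B9SupplySockB9P3ZdLettersOmega.isLandau138_restrictDom_iff L m i.η (i.Ω 0) (i.Λs m) U₀ A').2 hLanA
  obtain ⟨Jt, hJt_def⟩ : ∃ Jt : Site d → Fin d → 𝔸, Jt = deltaAOf i.η (ops M i m) U₀ Ain := ⟨_, rfl⟩
  have hGJ : (ops M i m).Gop U₀ Jt = Ain :=
    hinv α₀ U₀ hU₀ hα₀I hInA Ain hOn (fun y τ => by rw [hAin_def]; exact isSelfAdjoint_restrictDom hsa y τ) Jt
      fun y τ _ => by rw [hJt_def]
  have hDRD : ∀ (x : Site d) (μ : Fin d), (ops M i m).DRDs U₀ Ain x μ = 0 := hlan U₀ hU₀ Ain hOn hLanAin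
  have hJtb : ∀ (x : Site d) (μ : Fin d),
      Jt x μ = Jcur i.η U₀ Ain μ x + (ops M i m).Dp U₀ Ain x μ + (ops M i m).DRDs U₀ Ain x μ + (ops M i m).QQ U₀ Ain x μ := by
    intro x μ; rw [hJt_def]; rfl
  -- the right-hand side quantities: |J|₍₋₃₎ of the datum, |J(𝟙_{Ω₀}A′)|₍₋₃₎, |B₁|
  obtain ⟨nJ, hnJ_def⟩ : ∃ nJ : ℝ, nJ = bondNorm L m i.η (-(3 : ℝ)) i.Ω (fun x μ => Jcur i.η U₀ A' μ x) := ⟨_, rfl⟩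
  obtain ⟨nJi, hnJi_def⟩ : ∃ nJi : ℝ, nJi = bondNorm L m i.η (-(3 : ℝ)) i.Ω (fun x μ => Jcur i.η U₀ Ain μ x) := ⟨_, rfl⟩
  obtain ⟨nB, hnB_def⟩ : ∃ nB : ℝ, nB = wsup 1 (fun p : {p : ℕ × (Site d × Fin d) // p.1 ≤ m ∧ (p.2 ∈ ΛbP m p.1 ∨ (p.1 = 0 ∧ CrossB (i.Ω 0) p.2))} =>
      linCovIter L U₀ (iEta i.η A') p.1.1 p.1.2.1 p.1.2.2) := ⟨_, rfl⟩
  have hnJ0 : 0 ≤ nJ := by rw [hnJ_def]; exact B8ScaledSupNorm.msup_nonneg L m hη.le _ _ _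
  have hnB0 : 0 ≤ nB := by rw [hnB_def]; exact B8Eq155JBound.wsup_nonneg zero_le_one _
  have hnB_eq : wsup 1 (fun p : {p : ℕ × (Site d × Fin d) // p.1 ≤ m ∧ (p.2 ∈ ΛbP m p.1 ∨ (p.1 = 0 ∧ CrossB (i.Ω 0) p.2))} =>
      linCovIter L U₀ (iEta i.η Ain) p.1.1 p.1.2.1 p.1.2.2) = nB := by
    rw [hnB_def, hAin_def]
    exact wsupB1γ_restrictDom hL m i.η hsee U₀ A'
  -- |J(𝟙_{Ω₀}A′)|₍₋₃₎ ≤ |J(A′)|₍₋₃₎ + 16dΦ (the outer part sits at level 0)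
  have hnJi_le : nJi ≤ nJ + 16 * d * Φ := by
    rw [hnJi_def, hnJ_def, hAin_def]
    exact B9SupplySockB9P3ZdLettersOmega.bondNorm_jcur_restrict_le hL hη hMi hU₀1 hΦ0 hout hAglob
  -- the current of 𝟙_{Ω₀}A′ is bounded
  have hgrad : ∀ (y : Site d) (κ τ : Fin d), ‖covDerivFwd i.η U₀ κ (fun z => Ain z τ) y‖ ≤ i.η⁻¹ * (α₂ * i.η⁻¹ + α₂ * i.η⁻¹) :=
    fun y κ τ => (B9SupplySockB9P3ZdLettersOmega.norm_covDerivFwd_le hη (hU₀1 _ _) _).trans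
      (mul_le_mul_of_nonneg_left (add_le_add (hAin_glob _ _) (hAin_glob _ _)) (inv_nonneg.mpr hη.le))
  have hJbd : Bdd L m i.η (-(3 : ℝ)) (fun j (b : Site d × Fin d) => BondTouches (i.Ω j) b.1 b.2)
      (fun b => Jcur i.η U₀ Ain b.2 b.1) :=
    B9SupplySockB9P3Zd.bdd_neg_three_of_pointwise hL hη fun b => B9SupplySockB9P3Zd.norm_Jcur_le_of_grad hη hU₀1 hgrad b.2 b.1
  -- |J̃|₍₋₃₎ ≤ |J(𝟙_{Ω₀}A′)|₍₋₃₎ + c₆₉ M α₀ |𝟙_{Ω₀}A′|₍₋₁₎ + q |B₁| (pointwise: (3.26) with (3.69), the Landau condition, (3.16))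
  have hJt : bondNorm L m i.η (-(3 : ℝ)) i.Ω Jt ≤ nJi + c69 * M * α₀ * a + q * nB := by
    have e3 : (-(3 : ℝ)) = -((3 : ℕ) : ℝ) := by norm_num
    have hnJi0 : 0 ≤ nJi := by rw [hnJi_def]; exact B8ScaledSupNorm.msup_nonneg L m hη.le _ _ _
    refine B8ScaledSupNorm.msup_le (by positivity) fun j hj b hb => ?_
    have hw : weight L i.η (-(3 : ℝ)) j = ((L : ℝ) ^ j * i.η) ^ 3 := by
      rw [e3, B8ScaledSupNorm.weight_neg_natCast]
    have hw0 : 0 ≤ ((L : ℝ) ^ j * i.η) ^ 3 := by positivity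
    have h1 : weight L i.η (-(3 : ℝ)) j * ‖Jcur i.η U₀ Ain b.2 b.1‖ ≤ nJi := by
      rw [hnJi_def]; exact B8ScaledSupNorm.weight_mul_norm_le_msup hJbd hj hb
    have h2 : ((L : ℝ) ^ j * i.η) ^ 3 * ‖(ops M i m).Dp U₀ Ain b.1 b.2‖ ≤ c69 * M * α₀ * a := by
      rw [ha_def]; exact hcurv α₀ U₀ hU₀ hα₀ hInA Ain hOn j hj b.1 b.2 hb
    have h4 : ((L : ℝ) ^ j * i.η) ^ 3 * ‖(ops M i m).QQ U₀ Ain b.1 b.2‖ ≤ q * nB := by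
      rw [← hnB_eq]; exact havg U₀ hU₀ Ain hOn j hj b.1 b.2 hb
    have hsum : ‖Jt b.1 b.2‖ ≤
        ‖Jcur i.η U₀ Ain b.2 b.1‖ + ‖(ops M i m).Dp U₀ Ain b.1 b.2‖ + ‖(ops M i m).QQ U₀ Ain b.1 b.2‖ := by
      rw [hJtb, hDRD b.1 b.2, add_zero]
      exact norm_add₃_le
    rw [hw] at h1 ⊢
    calc ((L : ℝ) ^ j * i.η) ^ 3 * ‖Jt b.1 b.2‖
        ≤ ((L : ℝ) ^ j * i.η) ^ 3 *
            (‖Jcur i.η U₀ Ain b.2 b.1‖ + ‖(ops M i m).Dp U₀ Ain b.1 b.2‖ + ‖(ops M i m).QQ U₀ Ain b.1 b.2‖) :=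
          mul_le_mul_of_nonneg_left hsum hw0
      _ = ((L : ℝ) ^ j * i.η) ^ 3 * ‖Jcur i.η U₀ Ain b.2 b.1‖ + ((L : ℝ) ^ j * i.η) ^ 3 * ‖(ops M i m).Dp U₀ Ain b.1 b.2‖ +
            ((L : ℝ) ^ j * i.η) ^ 3 * ‖(ops M i m).QQ U₀ Ain b.1 b.2‖ := by ring
      _ ≤ nJi + c69 * M * α₀ * a + q * nB := add_le_add (add_le_add h1 h2) h4
  -- Theorem 3.3's γ = −3 global entries at J̃, read off the datum-keyed binder `GlobAtI` ((3.47) ⇒ (1.59) for 𝟙_{Ω₀}A′)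
  obtain ⟨hline1', hline2, hline4⟩ := hglob α₀ U₀ hU₀ hα₀ hα₀I hInA Jt
  rw [hGJ] at hline1' hline2 hline4
  have hline1 : a ≤ B₀ * bondNorm L m i.η (-(3 : ℝ)) i.Ω Jt := by rw [ha_def]; exact hline1'
  -- the a-priori (Neumann) step of G-IF-01 for 𝟙_{Ω₀}A′ with the source norm nJ + 16dΦ
  have hN : bondNorm L m i.η (-(3 : ℝ)) i.Ω Jt ≤ (nJ + 16 * d * Φ) + c69 * M * α₀ * a + q * nB := by
    linarith only [hJt, hnJi_le]
  have hnJ1 : 0 ≤ nJ + 16 * d * Φ := by positivity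
  obtain ⟨hA1, hA2, -, hA4, -⟩ := B9SupplySockB9P3Zd.apriori_arith (h := 0) (Cβ := 0) hB₀ hq hκ' hθ ha0 hnJ1 hnB0 le_rfl rfl hN hline1 hline2
    hline4 (by rw [zero_mul])
  -- bookkeeping constants
  obtain ⟨B', hB'_def⟩ : ∃ B' : ℝ, B' = max 1 (2 * B₀ * max 1 q) := ⟨_, rfl⟩
  have hB'1 : 1 ≤ B' := by rw [hB'_def]; exact le_max_left _ _
  rw [← hB'_def] at hA1 hA2 hA4 ⊢
  -- the four lines for A′ = 𝟙_{Ω₀}A′ + outer part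
  have hL1 : msup L m i.η (-(1 : ℝ)) (fun j (b : Site d × Fin d) => SideTouches (i.Ω j) b.1 b.2) (fun b => A' b.1 b.2) ≤ a + Φ := by
    rw [ha_def, hAin_def]
    exact B9SupplySockB9P3ZdLettersOmega.msup_side_le_restrict_add hη hMi hΦ0 hout hAbd
  have hL2 : msup L m i.η (-(2 : ℝ)) (fun j (t : Fin d × Fin d × Site d) => SideTouches (i.Ω j) t.2.2 t.2.1)
      (fun t => covDerivFwd i.η U₀ t.1 (fun z => A' z t.2.1) t.2.2) ≤
      msup L m i.η (-(2 : ℝ)) (fun j (t : Fin d × Fin d × Site d) => SideTouches (i.Ω j) t.2.2 t.2.1)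
        (fun t => covDerivFwd i.η U₀ t.1 (fun z => Ain z t.2.1) t.2.2) + 2 * Φ := by
    rw [hAin_def]
    exact B9SupplySockB9P3ZdLettersOmega.msup_grad_le_restrict_add hL hη hMi hU₀1 hΦ0 hout hAglob
  have hL4 : bondNorm L m i.η (-(3 : ℝ)) i.Ω (fun x μ => covLap i.η U₀ (fun z => A' z μ) x) ≤
      bondNorm L m i.η (-(3 : ℝ)) i.Ω (fun x μ => covLap i.η U₀ (fun z => Ain z μ) x) + 4 * d * Φ := by
    rw [hAin_def]
    exact B9SupplySockB9P3ZdLettersOmega.bondNorm_covLap_le_restrict_add hL hη hMi hU₀1 hΦ0 hout hAglob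
  have hJJ : bondNorm L m i.η (-(3 : ℝ)) i.Ω (fun x μ => pdiv i.η U₀ (plaqCovDeriv i.η U₀ A') μ x) = nJ := by
    rw [hnJ_def]; rfl
  -- name the remaining large terms, so that the final arithmetic runs on atoms
  obtain ⟨l1, hl1_def⟩ : ∃ l1 : ℝ,
      l1 = msup L m i.η (-(1 : ℝ)) (fun j (b : Site d × Fin d) => SideTouches (i.Ω j) b.1 b.2) (fun b => A' b.1 b.2) := ⟨_, rfl⟩
  obtain ⟨l2, hl2_def⟩ : ∃ l2 : ℝ, l2 = msup L m i.η (-(2 : ℝ)) (fun j (t : Fin d × Fin d × Site d) => SideTouches (i.Ω j) t.2.2 t.2.1)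
      (fun t => covDerivFwd i.η U₀ t.1 (fun z => A' z t.2.1) t.2.2) := ⟨_, rfl⟩
  obtain ⟨g2, hg2_def⟩ : ∃ g2 : ℝ, g2 = msup L m i.η (-(2 : ℝ)) (fun j (t : Fin d × Fin d × Site d) => SideTouches (i.Ω j) t.2.2 t.2.1)
      (fun t => covDerivFwd i.η U₀ t.1 (fun z => Ain z t.2.1) t.2.2) := ⟨_, rfl⟩
  obtain ⟨l4, hl4_def⟩ : ∃ l4 : ℝ, l4 = bondNorm L m i.η (-(3 : ℝ)) i.Ω (fun x μ => covLap i.η U₀ (fun z => A' z μ) x) := ⟨_, rfl⟩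
  obtain ⟨g4, hg4_def⟩ : ∃ g4 : ℝ, g4 = bondNorm L m i.η (-(3 : ℝ)) i.Ω (fun x μ => covLap i.η U₀ (fun z => Ain z μ) x) := ⟨_, rfl⟩
  rw [← hl1_def] at hL1
  rw [← hl2_def, ← hg2_def] at hL2
  rw [← hg2_def] at hA2
  rw [← hl4_def, ← hg4_def] at hL4
  rw [← hg4_def] at hA4
  rw [← hnJ_def, ← hnB_def, ← hΦ_def, hJJ, ← hl1_def, ← hl2_def, ← hl4_def]
  have hd4 : (1 : ℝ) ≤ 4 * d + 2 := by linarith only [hd1]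
  refine ⟨?_, ?_, ?_, ?_⟩
  · exact collar_arith (e := 1) hB'1 hΦ0 hd4 (by linarith only [hL1, hA1])
  · exact collar_arith (e := 2) hB'1 hΦ0 (by linarith only [hd1]) (by linarith only [hL2, hA2])
  · refine collar_arith (e := 0) hB'1 hΦ0 (by linarith only [hd1]) ?_
    have h1 : nJ ≤ B' * nJ := le_mul_of_one_le_left hnJ0 hB'1
    have h2 : 0 ≤ B' * (16 * d * Φ + nB) := by positivity
    calc nJ ≤ B' * nJ := h1
      _ ≤ B' * nJ + B' * (16 * d * Φ + nB) := le_add_of_nonneg_right h2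
      _ = B' * (nJ + 16 * d * Φ + nB) + 0 * Φ := by ring
  · exact collar_arith (e := 4 * d) hB'1 hΦ0 (by linarith only [hd1]) (by linarith only [hL4, hA4])

end Supply

end Literature.MathematicalPhysics.QuantumFieldTheory.Balaban1983to89.B9SupplySockB9P3ZdDatum

end
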